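import Mathlib
import Literature.NumberTheory.Automorphic.HyperbolicLaplaceSpectrum
import HarnessLib

/-!
# Certified Maass–Hecke trace census: certificate format, exact post-processing, semantics

Compute-infrastructure for route `Summits/Langlands/Langlands/Theses/QuarterDeficit1951.lean`
(crux `QuarterFingerprintDeficit`, verdict class *computation*): the Lean side of a census of the
weight-`0` cuspidal spectrum of `(Γ₀(N), χ)` near `λ = 1/4` obtained by evaluating a Selberg(–Hecke)
trace formula in ball arithmetic, in the manner of Booker–Strömbergsson and
Booker–Lee–Strömbergsson [BLS20, §5] (test functions `h(r) = (sinc²(δr/2) Σ_{j<M} x_j cos(jδr))²`,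
`δ = X/2M`, all real/complex quantities as Arb balls).

## What is here

1. **Format** (§1–3, computable, kernel-decidable). `QIvl`/`QCBox`: rational intervals and complex
   boxes (the shape of Arb `arb`/`acb` output) with the handful of sound operations the
   post-processing needs (`add`, `sub`, Moore `mul`, `widen`, `divPos`, `sq`, and two-sided bounds
   `distSqLower`/`distSqUpper` for the squared distance from a box to a real interval).
   `SqTestFn`: the BLS test function as a function of the eigenvalue `λ` (real branch
   `r = √(λ - 1/4)`, imaginary branch `r = i√(1/4 - λ)`), a square, hence `≥ 0` (`eval_nonneg`).
   `MaassHeckeTraceCensus`: the transcript for ONE character — boxes for the traces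
   `m_n(h) = Σ_j h(r_j) λ_j(n)` (`n = 1` and the fingerprint primes), certified window bounds
   `hlo ≤ h ≤ hhi` on `|λ - 1/4| ≤ window`, rational Hecke bounds `C_n ≥ σ(n)/√n`, boxes for
   `conj χ(p)`, an optional tail slot `(g, B)` (`g ≥ h` off the window, `B ∋ Σ_j g(r_j)`).
   From these, IN EXACT ARITHMETIC: the upper count `U = ⌊m1hi/hlo⌋₊` of eigenvalues in the window
   (the upper-bound device of [BLS20, §5]), the lower count `L`, the enclosure `muBox p` of the
   Hecke eigenvalue `λ_⋆(p)` of a unique window line (`h(r_⋆)λ_⋆(p) = m_p(h) - Σ_{j≠⋆} h(r_j)λ_j(p)`,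
   the off-window sum bounded by `C_p · tailHi`, then division by `h(r_⋆) ∈ hStar`), the enclosure
   `fpBox p` of the fingerprint quantity `λ_⋆(p)² conj χ(p)`, its certified distance to the
   icosahedral set `Φ = {0, 1, 4, (3±√5)/2}` (`phiEnclosures`, `violates`, `matchesFp`), and the two
   verdicts `certifiesDeficit` (`U = 0`, or `U = 1` and the fingerprint violated at some `p`) and
   `certifiesSighting` (`U = 1 ≤ L` and the fingerprint matched at every `p`) — `Bool`s that
   `decide +kernel` evaluates on a transcribed census (tested on toy data).
2. **Semantics** (§4). `IsMaassCuspFormOn N χ u λ` (weight-`0` Maass cusp forms with nebentypus,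
   [BLS20, §1.1], in the vocabulary of `HyperbolicLaplaceSpectrum` and of the route statements),
   the Hecke operators `maassHeckeOp N χ n` ([BLS20, §1.1]; `maassHeckeOp_prime` is the inlined
   route shape), joint spectral data `IsJointSpectralData` (a linearly independent, complete joint
   eigenbasis listing the cuspidal spectrum with multiplicity, `λ_j > 0`, `λ_j(1) = 1`, the trivial
   bound `|λ_j(n)| ≤ σ(n)/√n`), what the boxes assert about such data (`EnclosesSpectralData`), and
   THE NOTION `CertifiedMaassHeckeTraceCensus N χ c : Prop` — "`c` is a well-formed level-`N`
   transcript whose boxes enclose the `h`-weighted Hecke traces of the cuspidal spectrum of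
   `(Γ₀(N), χ)`". This `Prop` is what an Arb run certifies; no in-kernel checker of it is claimed.
3. **Decoding** (§5, proved). Soundness of every post-processing step against the semantics
   (`not_inWindow_of_upperCount_eq_zero`, `window_subsingleton_of_upperCount_eq_one`, `tail_le`,
   `weight_mem_hStar`, `hecke_mem_muBox`, `fp_mem_fpBox`, `exists_inWindow_of_one_le_lowerCount`,
   and the linear algebra `exists_line_of_mem_span` locating a joint eigenform in the data), and
   the two decoding theorems: `not_fingerprinted` (certified census + deficit verdict ⇒ every
   non-zero window form that is a `T_p`-eigenfunction at the fingerprint primes misses `Φ` by more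
   than `fpTol` at some `p`; for `U = 0` there is no window form at all) and `exists_fingerprinted`
   (certified census + sighting verdict ⇒ a non-zero window form with the fingerprint within `fpTol`
   exists). With `N = 1951`, `window = fpTol = 1/100`, `fpPrimes = [2,3,5,7,11,13]` these are the
   two outcomes of the crux, per character.

## Scope and faithfulness notes

* [BLS20] state and implement the trace formula for `tr T_n h` with `n ∈ {±1}` only (Thm 7 and the
  full formula of their §2, for `(Γ₀(N), χ)`; §5: `M = 200`, `X ≤ 40`, class numbers of
  `ℚ(√(t² ∓ 4))` for `t ≤ e^{20}`); the boxes for `m_p(h)`, `p > 1`, require a trace formula for Hecke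
  operators on `(Γ₀(N), χ)`, which is NOT in [BLS20]. The format and the theorems here do not depend
  on how the enclosures are produced.
* `IsJointSpectralData` packages standard spectral theory (self-adjointness and discreteness of `Δ`
  on the cuspidal subspace, finite-dimensionality of `A_λ(χ)`, simultaneous diagonalisability of the
  normal commuting `T_n`, `(n, N) = 1`, boundedness `‖T_n‖ ≤ σ(n)/√n`) as the HYPOTHESES under which
  a census speaks about Maass forms; it is part of the meaning of "certified", not proved here.
* Square-integrability in [BLS20, §1.1] is rendered as "bounded + cuspidal at every cusp"
  (equivalent for cusp forms); cuspidality is the period-`N` integral condition at `g · ∞` for all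
  `g ∈ SL₂(ℤ)`, which at a cusp irregular for `χ` holds automatically and at a regular cusp is the
  vanishing of the constant term. For prime `N` the cusps are `∞` and `0`, as in the route.
* Window multiplicity `≥ 2` (several lines in the window) yields NO verdict here; separating such
  lines needs traces of `T_{p²}` and a different post-processing, deliberately not included.
* Junk values: missing boxes read as the zero box and missing `C_n` as `0` (excluded by
  `wellFormed`); an interval with `hi < lo` has no members, which only makes `EnclosesSpectralData`
  unsatisfiable; `maassHeckeOp N χ 0 = 0`.

## How a transcript is used

The compute lane prints the Arb output as a term `def census_χ : MaassHeckeTraceCensus := {…}`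
(exact rationals), proves `census_χ.certifiesDeficit = true` (or `certifiesSighting`) by
`decide +kernel`, and attaches the Arb log as evidence for the `Prop`
`CertifiedMaassHeckeTraceCensus 1951 χ census_χ` (verdict class computation); the decoding theorems
then give the per-character statement of the crux or its negation.

## References

* [BookerLeeStrombergsson2020] A. R. Booker, M. Lee, A. Strömbergsson, *Twist-minimal trace
  formulas and the Selberg eigenvalue conjecture*, J. LMS 102 (2020), arXiv:1803.06016: §1.1
  (the spaces `A_λ(χ)`, `T_n`), §1.2 Thm 7 (trace formula, `n = ±1`), §5 (test functions, Arb,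
  `M = 200`, `X ≤ 40`). Read from the arXiv source, 2026-08-16.
* [Moore1966] R. E. Moore, *Interval Analysis*, Prentice-Hall 1966, §2.2, Thm 3.1 (Moore product,
  inclusion property) — as in `Literature/Analysis/ValidatedNumerics/IntervalEnclosure.lean`, whose
  `NonemptyInterval.mooreMul` is the same operation on proof-carrying intervals; here raw endpoint
  pairs are used so that transcripts are plain literals.
-/

namespace Literature.NumberTheory.Automorphic

open scoped BigOperators ComplexConjugate UpperHalfPlane

/-! ## 1. Rational intervals and complex boxes (the shape of Arb `arb` / `acb` output) -/

/-- A closed rational interval `[lo, hi]` (no point satisfies it when `hi < lo`); the shape of an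
Arb real ball `mid ± rad` written with exact rational endpoints. [folklore] -/
structure QIvl where
  /-- left endpoint -/
  lo : ℚ
  /-- right endpoint -/
  hi : ℚ
  deriving DecidableEq, Repr

namespace QIvl

/-- `x ∈ [lo, hi]`. [folklore] -/
def mem (I : QIvl) (x : ℝ) : Prop := (I.lo : ℝ) ≤ x ∧ x ≤ I.hi

/-- Interval sum. [folklore] -/
def add (I J : QIvl) : QIvl := ⟨I.lo + J.lo, I.hi + J.hi⟩

/-- Interval difference. [folklore] -/
def sub (I J : QIvl) : QIvl := ⟨I.lo - J.hi, I.hi - J.lo⟩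

/-- The Moore product (min / max of the four endpoint products). [cite: Moore1966, §2.2] -/
def mul (I J : QIvl) : QIvl :=
  ⟨min (min (I.lo * J.lo) (I.lo * J.hi)) (min (I.hi * J.lo) (I.hi * J.hi)),
   max (max (I.lo * J.lo) (I.lo * J.hi)) (max (I.hi * J.lo) (I.hi * J.hi))⟩

/-- Widening by `e` on both sides. [folklore] -/
def widen (I : QIvl) (e : ℚ) : QIvl := ⟨I.lo - e, I.hi + e⟩

/-- Enclosure of the quotients `x / d`, `x ∈ I`, `d ∈ D`, for a POSITIVE divisor interval `D`
(`0 < D.lo`; junk otherwise). [cite: Moore1966, §2.2] -/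
def divPos (I D : QIvl) : QIvl :=
  ⟨min (I.lo / D.lo) (I.lo / D.hi), max (I.hi / D.lo) (I.hi / D.hi)⟩

variable {I J D : QIvl} {x y d e : ℝ}

/-- Soundness of `add`. [folklore] -/
theorem mem_add (hx : I.mem x) (hy : J.mem y) : (I.add J).mem (x + y) := by
  obtain ⟨h1, h2⟩ := hx; obtain ⟨h3, h4⟩ := hy
  constructor <;> push_cast [add] <;> linarith

/-- Soundness of `sub`. [folklore] -/
theorem mem_sub (hx : I.mem x) (hy : J.mem y) : (I.sub J).mem (x - y) := by
  obtain ⟨h1, h2⟩ := hx; obtain ⟨h3, h4⟩ := hy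
  constructor <;> push_cast [sub] <;> linarith

/-- One-variable Moore bound: for `a ≤ x ≤ b`, `x * y` lies between `a * y` and `b * y`. [folklore] -/
theorem min_mul_le_mul_le_max {a b : ℝ} (ha : a ≤ x) (hb : x ≤ b) (y : ℝ) :
    min (a * y) (b * y) ≤ x * y ∧ x * y ≤ max (a * y) (b * y) := by
  rcases le_total 0 y with hy | hy
  · exact ⟨(min_le_left _ _).trans (mul_le_mul_of_nonneg_right ha hy),
      (mul_le_mul_of_nonneg_right hb hy).trans (le_max_right _ _)⟩
  · exact ⟨(min_le_right _ _).trans (mul_le_mul_of_nonpos_right hb hy),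
      (mul_le_mul_of_nonpos_right ha hy).trans (le_max_left _ _)⟩

/-- **Inclusion property of the Moore product.** [cite: Moore1966, Theorem 3.1] -/
theorem mem_mul (hx : I.mem x) (hy : J.mem y) : (I.mul J).mem (x * y) := by
  obtain ⟨h1, h2⟩ := hx; obtain ⟨h3, h4⟩ := hy
  have A := min_mul_le_mul_le_max h1 h2 y
  have Blo := min_mul_le_mul_le_max h3 h4 (I.lo : ℝ)
  have Bhi := min_mul_le_mul_le_max h3 h4 (I.hi : ℝ)
  simp only [mul_comm _ (I.lo : ℝ), mul_comm _ (I.hi : ℝ)] at Blo Bhi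
  constructor
  · push_cast [mul]
    calc min (min ((I.lo : ℝ) * J.lo) (I.lo * J.hi)) (min ((I.hi : ℝ) * J.lo) (I.hi * J.hi))
        ≤ min ((I.lo : ℝ) * y) (I.hi * y) := min_le_min Blo.1 Bhi.1
      _ ≤ x * y := A.1
  · push_cast [mul]
    calc x * y ≤ max ((I.lo : ℝ) * y) (I.hi * y) := A.2
      _ ≤ max (max ((I.lo : ℝ) * J.lo) (I.lo * J.hi)) (max ((I.hi : ℝ) * J.lo) (I.hi * J.hi)) :=
          max_le_max Blo.2 Bhi.2

/-- Soundness of `widen`: perturbations of size `≤ e` stay inside `I.widen e`. [folklore] -/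
theorem mem_widen {q : ℚ} (hx : I.mem x) (he : |e| ≤ q) : (I.widen q).mem (x + e) := by
  obtain ⟨h1, h2⟩ := hx
  obtain ⟨h3, h4⟩ := abs_le.mp he
  constructor <;> push_cast [widen] <;> linarith

/-- Soundness of `divPos`. [cite: Moore1966, Theorem 3.1] -/
theorem mem_divPos (hx : I.mem x) (hd : D.mem d) (hD : 0 < D.lo) : (I.divPos D).mem (x / d) := by
  obtain ⟨h1, h2⟩ := hx; obtain ⟨h3, h4⟩ := hd
  have hD' : (0 : ℝ) < D.lo := by exact_mod_cast hD
  have hd0 : 0 < d := hD'.trans_le h3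
  have hDhi : (0 : ℝ) < D.hi := hd0.trans_le h4
  constructor
  · push_cast [divPos]
    rcases le_total 0 x with hx0 | hx0
    · calc min ((I.lo : ℝ) / D.lo) (I.lo / D.hi) ≤ I.lo / D.hi := min_le_right _ _
        _ ≤ x / D.hi := div_le_div_of_nonneg_right h1 hDhi.le
        _ ≤ x / d := div_le_div_of_nonneg_left hx0 hd0 h4
    · calc min ((I.lo : ℝ) / D.lo) (I.lo / D.hi) ≤ I.lo / D.lo := min_le_left _ _
        _ ≤ x / D.lo := div_le_div_of_nonneg_right h1 hD'.le
        _ ≤ x / d := by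
          rw [div_le_div_iff₀ hD' hd0]
          nlinarith
  · push_cast [divPos]
    rcases le_total 0 x with hx0 | hx0
    · calc x / d ≤ x / D.lo := div_le_div_of_nonneg_left hx0 hD' h3
        _ ≤ I.hi / D.lo := div_le_div_of_nonneg_right h2 hD'.le
        _ ≤ max ((I.hi : ℝ) / D.lo) (I.hi / D.hi) := le_max_left _ _
    · calc x / d ≤ x / D.hi := by
            rw [div_le_div_iff₀ hd0 hDhi]
            nlinarith
        _ ≤ I.hi / D.hi := div_le_div_of_nonneg_right h2 hDhi.le
        _ ≤ max ((I.hi : ℝ) / D.lo) (I.hi / D.hi) := le_max_right _ _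

/-- A member forces `lo ≤ hi` and lies above `lo`. [folklore] -/
theorem lo_le (hx : I.mem x) : (I.lo : ℝ) ≤ x := hx.1

end QIvl

/-- A complex box with rational sides (the shape of an Arb `acb`: a real and an imaginary ball). [folklore] -/
structure QCBox where
  /-- enclosure of the real part -/
  re : QIvl
  /-- enclosure of the imaginary part -/
  im : QIvl
  deriving DecidableEq, Repr

namespace QCBox

/-- `z ∈ B`: both coordinates lie in their intervals. [folklore] -/
def mem (B : QCBox) (z : ℂ) : Prop := B.re.mem z.re ∧ B.im.mem z.im

/-- The zero box (junk value for missing data). [folklore] -/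
def zero : QCBox := ⟨⟨0, 0⟩, ⟨0, 0⟩⟩

/-- Widening both coordinates by `e`. [folklore] -/
def widen (B : QCBox) (e : ℚ) : QCBox := ⟨B.re.widen e, B.im.widen e⟩

/-- Enclosure of complex products: `(a+bi)(c+di) = (ac-bd) + (ad+bc)i` in interval arithmetic.
[cite: Moore1966, §2.2] -/
def mul (A B : QCBox) : QCBox :=
  ⟨(A.re.mul B.re).sub (A.im.mul B.im), (A.re.mul B.im).add (A.im.mul B.re)⟩

/-- Enclosure of complex squares. [folklore] -/
def sq (A : QCBox) : QCBox := A.mul A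

/-- Enclosure of `z / d` for `z ∈ B` and a real `d` in the positive interval `D`. [folklore] -/
def divPos (B : QCBox) (D : QIvl) : QCBox := ⟨B.re.divPos D, B.im.divPos D⟩

/-- A LOWER bound for `‖z - x‖²` over `z ∈ B` and real `x ∈ I` (coordinate gaps). [folklore] -/
def distSqLower (B : QCBox) (I : QIvl) : ℚ :=
  max 0 (max (B.re.lo - I.hi) (I.lo - B.re.hi)) ^ 2 + max 0 (max B.im.lo (-B.im.hi)) ^ 2

/-- An UPPER bound for `‖z - x‖²` over `z ∈ B` and real `x ∈ I`. [folklore] -/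
def distSqUpper (B : QCBox) (I : QIvl) : ℚ :=
  max (max |B.re.lo - I.lo| |B.re.lo - I.hi|) (max |B.re.hi - I.lo| |B.re.hi - I.hi|) ^ 2 +
    max |B.im.lo| |B.im.hi| ^ 2

variable {A B : QCBox} {I D : QIvl} {z w : ℂ} {x d : ℝ}

/-- Soundness of `widen`: `z + w ∈ B.widen e` whenever `z ∈ B` and `‖w‖ ≤ e`. [folklore] -/
theorem mem_widen {e : ℚ} (hz : B.mem z) (hw : ‖w‖ ≤ e) : (B.widen e).mem (z + w) := by
  refine ⟨?_, ?_⟩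
  · rw [Complex.add_re]; exact QIvl.mem_widen hz.1 ((Complex.abs_re_le_norm w).trans hw)
  · rw [Complex.add_im]; exact QIvl.mem_widen hz.2 ((Complex.abs_im_le_norm w).trans hw)

/-- Soundness of `mul`. [cite: Moore1966, Theorem 3.1] -/
theorem mem_mul (hz : A.mem z) (hw : B.mem w) : (A.mul B).mem (z * w) := by
  refine ⟨?_, ?_⟩
  · rw [Complex.mul_re]
    exact QIvl.mem_sub (QIvl.mem_mul hz.1 hw.1) (QIvl.mem_mul hz.2 hw.2)
  · rw [Complex.mul_im]
    exact QIvl.mem_add (QIvl.mem_mul hz.1 hw.2) (QIvl.mem_mul hz.2 hw.1)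

/-- Soundness of `sq`. [folklore] -/
theorem mem_sq (hz : A.mem z) : A.sq.mem (z ^ 2) := by
  rw [pow_two]; exact mem_mul hz hz

/-- Soundness of `divPos`. [folklore] -/
theorem mem_divPos (hz : B.mem z) (hd : D.mem d) (hD : 0 < D.lo) : (B.divPos D).mem (z / d) := by
  refine ⟨?_, ?_⟩
  · rw [Complex.div_ofReal_re]; exact QIvl.mem_divPos hz.1 hd hD
  · rw [Complex.div_ofReal_im]; exact QIvl.mem_divPos hz.2 hd hD

/-- For `a ≤ t ≤ b` and `c ≤ s ≤ d`: `|t - s| ≤ max (max |a-c| |a-d|) (max |b-c| |b-d|)`. [folklore] -/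
theorem abs_sub_le_max4 {a b c e t s : ℝ} (ha : a ≤ t) (hb : t ≤ b) (hc : c ≤ s) (he : s ≤ e) :
    |t - s| ≤ max (max |a - c| |a - e|) (max |b - c| |b - e|) := by
  rw [abs_le]
  constructor
  · have h1 : -(max (max |a - c| |a - e|) (max |b - c| |b - e|)) ≤ -|a - e| := by
      simp only [neg_le_neg_iff]
      exact (le_max_right _ _).trans (le_max_left _ _)
    refine h1.trans ?_
    have := neg_abs_le (a - e)
    linarith
  · refine le_trans ?_ ((le_max_left _ _).trans (le_max_right _ _))
    have := le_abs_self (b - c)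
    linarith

/-- **`distSqLower` is a lower bound**: `distSqLower B I ≤ ‖z - x‖²` for `z ∈ B`, `x ∈ I` real. [folklore] -/
theorem distSqLower_le (hz : B.mem z) (hx : I.mem x) :
    ((B.distSqLower I : ℚ) : ℝ) ≤ ‖z - x‖ ^ 2 := by
  obtain ⟨⟨h1, h2⟩, ⟨h3, h4⟩⟩ := hz
  obtain ⟨h5, h6⟩ := hx
  rw [Complex.sq_norm, Complex.normSq_apply]
  simp only [Complex.sub_re, Complex.ofReal_re, Complex.sub_im, Complex.ofReal_im, sub_zero]
  push_cast [distSqLower]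
  have hre : max 0 (max ((B.re.lo : ℝ) - I.hi) (I.lo - B.re.hi)) ^ 2 ≤ (z.re - x) * (z.re - x) := by
    rw [← abs_mul_abs_self (z.re - x), pow_two]
    have h0 : (0 : ℝ) ≤ max 0 (max ((B.re.lo : ℝ) - I.hi) (I.lo - B.re.hi)) := le_max_left _ _
    have hle : max 0 (max ((B.re.lo : ℝ) - I.hi) (I.lo - B.re.hi)) ≤ |z.re - x| := by
      refine max_le (abs_nonneg _) (max_le ?_ ?_)
      · exact le_trans (by linarith) (le_abs_self _)
      · exact le_trans (by linarith) (neg_le_abs _)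
    exact mul_self_le_mul_self h0 hle
  have him : max 0 (max (B.im.lo : ℝ) (-B.im.hi)) ^ 2 ≤ z.im * z.im := by
    rw [← abs_mul_abs_self z.im, pow_two]
    have h0 : (0 : ℝ) ≤ max 0 (max (B.im.lo : ℝ) (-B.im.hi)) := le_max_left _ _
    have hle : max 0 (max (B.im.lo : ℝ) (-B.im.hi)) ≤ |z.im| := by
      refine max_le (abs_nonneg _) (max_le ?_ ?_)
      · exact le_trans h3 (le_abs_self _)
      · exact le_trans (by linarith) (neg_le_abs _)
    exact mul_self_le_mul_self h0 hle
  linarith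

/-- **`distSqUpper` is an upper bound**: `‖z - x‖² ≤ distSqUpper B I` for `z ∈ B`, `x ∈ I` real. [folklore] -/
theorem normSq_le_distSqUpper (hz : B.mem z) (hx : I.mem x) :
    ‖z - x‖ ^ 2 ≤ ((B.distSqUpper I : ℚ) : ℝ) := by
  obtain ⟨⟨h1, h2⟩, ⟨h3, h4⟩⟩ := hz
  obtain ⟨h5, h6⟩ := hx
  rw [Complex.sq_norm, Complex.normSq_apply]
  simp only [Complex.sub_re, Complex.ofReal_re, Complex.sub_im, Complex.ofReal_im, sub_zero]
  push_cast [distSqUpper]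
  have hre : (z.re - x) * (z.re - x) ≤
      max (max |(B.re.lo : ℝ) - I.lo| |(B.re.lo : ℝ) - I.hi|) (max |(B.re.hi : ℝ) - I.lo| |(B.re.hi : ℝ) - I.hi|) ^ 2 := by
    rw [← abs_mul_abs_self (z.re - x), pow_two]
    have hle := abs_sub_le_max4 h1 h2 h5 h6
    exact mul_self_le_mul_self (abs_nonneg _) hle
  have him : z.im * z.im ≤ max |(B.im.lo : ℝ)| |(B.im.hi : ℝ)| ^ 2 := by
    rw [← abs_mul_abs_self z.im, pow_two]
    have hle : |z.im| ≤ max |(B.im.lo : ℝ)| |(B.im.hi : ℝ)| := by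
      rw [abs_le]
      constructor
      · have := neg_abs_le (B.im.lo : ℝ)
        have := le_max_left |(B.im.lo : ℝ)| |(B.im.hi : ℝ)|
        linarith
      · exact (le_abs_self _ |>.trans' h4 |> fun h => h.trans (le_max_right _ _))
    exact mul_self_le_mul_self (abs_nonneg _) hle
  linarith

end QCBox

/-! ## 2. Test functions of Booker–Strömbergsson type, as functions of the Laplace eigenvalue -/

/-- A test function of the family used in [BLS20, §5]:
`h(r) = (sinc²(δ r / 2) · Σ_{j < M} x_j cos(j δ r))²` with `δ = delta` and `x = coeffs`
(there `δ = X / 2M`, `M = 200`, `X ≤ 40`). [cite: BookerLeeStrombergsson2020, §5] -/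
structure SqTestFn where
  /-- the step `δ = X / 2M` -/
  delta : ℚ
  /-- the coefficients `x_0, …, x_{M-1}` -/
  coeffs : List ℚ
  deriving DecidableEq, Repr

namespace SqTestFn

/-- The value `h(r_λ)` at the spectral parameter `r_λ = √(λ - 1/4)` of a Laplace eigenvalue `λ`,
written as a REAL function of `λ`: for `λ ≥ 1/4`, `r = √(λ - 1/4)` is real and
`h = (sinc²(δr/2) Σ x_j cos(jδr))²`; for `λ < 1/4`, `r = it` with `t = √(1/4 - λ)` and
`sinc(δ i t/2) = sinh(δt/2)/(δt/2)`, `cos(jδ i t) = cosh(jδt)`, so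
`h = ((sinh(δt/2)/(δt/2))² Σ x_j cosh(jδt))²`. In both cases `h(r_λ)` is a real square.
[cite: BookerLeeStrombergsson2020, §5] -/
noncomputable def eval (f : SqTestFn) (lam : ℝ) : ℝ :=
  if 1 / 4 ≤ lam then
    (Real.sinc ((f.delta : ℝ) * Real.sqrt (lam - 1 / 4) / 2) ^ 2 *
      ∑ j ∈ Finset.range f.coeffs.length,
        (f.coeffs.getD j 0 : ℝ) * Real.cos (j * (f.delta : ℝ) * Real.sqrt (lam - 1 / 4))) ^ 2
  else
    ((Real.sinh ((f.delta : ℝ) * Real.sqrt (1 / 4 - lam) / 2) /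
        ((f.delta : ℝ) * Real.sqrt (1 / 4 - lam) / 2)) ^ 2 *
      ∑ j ∈ Finset.range f.coeffs.length,
        (f.coeffs.getD j 0 : ℝ) * Real.cosh (j * (f.delta : ℝ) * Real.sqrt (1 / 4 - lam))) ^ 2

/-- `h(r_λ) ≥ 0` on the whole possible spectrum (it is a square). [cite: BookerLeeStrombergsson2020, §5] -/
theorem eval_nonneg (f : SqTestFn) (lam : ℝ) : 0 ≤ f.eval lam := by
  unfold eval; split_ifs <;> positivity

end SqTestFn

/-! ## 3. The census certificate: data, exact post-processing, verdicts (all computable) -/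

/-- **A Maass–Hecke trace census** for one pair (level `N`, nebentypus `χ`): the transcript of an
interval-arithmetic evaluation of the cuspidal traces `m_n(h) = Σ_j h(r_j) λ_j(n)` (`T_n`-Hecke
traces weighted by a test function `h`, over the weight-`0` cuspidal spectrum of `(Γ₀(N), χ)`),
together with the certified shape data of `h` on the eigenvalue window `|λ - 1/4| ≤ window` and the
bookkeeping needed to post-process it exactly. Which statements about the spectrum the boxes
assert is `MaassHeckeTraceCensus.EnclosesSpectralData` (§5); the certificate itself is pure data.
[cite: BookerLeeStrombergsson2020, §1.1, §5] -/
structure MaassHeckeTraceCensus where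
  /-- the level `N` -/
  level : ℕ
  /-- the eigenvalue window is `|λ - 1/4| ≤ window` (i.e. `|r| ≤ √window`) -/
  window : ℚ
  /-- the primes `p` at which Hecke eigenvalues are fingerprinted -/
  fpPrimes : List ℕ
  /-- the fingerprint tolerance -/
  fpTol : ℚ
  /-- the nonnegative test function `h` (majorant slot) -/
  maj : SqTestFn
  /-- certified: `hlo ≤ h(r_λ)` for every `λ > 0` in the window -/
  hlo : ℚ
  /-- certified: `h(r_λ) ≤ hhi` for every `λ > 0` in the window -/
  hhi : ℚ
  /-- `n ↦` a box containing `m_n(h) = Σ_j h(r_j) λ_j(n)`; must contain `n = 1` and every `p ∈ fpPrimes` -/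
  traces : List (ℕ × QCBox)
  /-- `n ↦ C_n`, a rational bound `σ(n)/√n ≤ C_n` for the Hecke eigenvalues `|λ_j(n)|` -/
  heckeC : List (ℕ × ℚ)
  /-- `p ↦` a box containing `conj (χ p)` -/
  chiBoxes : List (ℕ × QCBox)
  /-- optional tail slot: a test function `g ≥ h` off the window, and an interval containing `Σ_j g(r_j)` -/
  tail : Option (SqTestFn × QIvl)
  deriving Repr

namespace MaassHeckeTraceCensus

variable (c : MaassHeckeTraceCensus)

/-- The box recorded for `m_n(h)` (the zero box if absent — excluded by `wellFormed`). [folklore] -/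
def trace (n : ℕ) : QCBox := (c.traces.lookup n).getD QCBox.zero

/-- The recorded Hecke bound `C_n` (`0` if absent). [folklore] -/
def C (n : ℕ) : ℚ := (c.heckeC.lookup n).getD 0

/-- The box recorded for `conj (χ p)` (zero box if absent). [folklore] -/
def chiBox (p : ℕ) : QCBox := (c.chiBoxes.lookup p).getD QCBox.zero

/-- Upper endpoint of the real part of the box of `m_1(h) = Σ_j h(r_j)`. [folklore] -/
def m1hi : ℚ := (c.trace 1).re.hi

/-- Lower endpoint of the real part of the box of `m_1(h)`. [folklore] -/
def m1lo : ℚ := (c.trace 1).re.lo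

/-- **Upper count** `U = ⌊m1hi / hlo⌋₊`: since `h ≥ 0` on the spectrum and `h ≥ hlo` on the window,
`#{j : |λ_j - 1/4| ≤ window} · hlo ≤ Σ_j h(r_j) ≤ m1hi` (the upper-bound device of
[BLS20, §5] / [BS07]). [cite: BookerLeeStrombergsson2020, §5] -/
def upperCount : ℕ := ⌊c.m1hi / c.hlo⌋₊

/-- **Tail bound**: an upper bound for `Σ_{j off the window} h(r_j)` valid when at least one `r_j`
lies in the window: `m1hi - hlo`, improved to the tail slot's `Σ_j g(r_j) ≤ B.hi` when present. [folklore] -/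
def tailHi : ℚ :=
  match c.tail with
  | none => c.m1hi - c.hlo
  | some (_, B) => min B.hi (c.m1hi - c.hlo)

/-- **Lower count** `L`: with a tail slot `(g, B)`, `Σ_window h(r_j) ≥ m1lo - B.hi`, and each window
term is `≤ hhi`, so `#window ≥ (m1lo - B.hi) / hhi`; `L = ⌈(m1lo - B.hi)/hhi⌉₊` (`0` without a
tail slot). Only `1 ≤ L` (existence of a window eigenvalue) is used below. [folklore] -/
def lowerCount : ℕ :=
  match c.tail with
  | none => 0
  | some (_, B) => ⌈(c.m1lo - B.hi) / c.hhi⌉₊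

/-- Enclosure of `h(r_⋆)` for THE window line `⋆` when it is the only one:
`max hlo (m1lo - tailHi) ≤ h(r_⋆) ≤ min hhi m1hi`. [folklore] -/
def hStar : QIvl := ⟨max c.hlo (c.m1lo - c.tailHi), min c.hhi c.m1hi⟩

/-- Enclosure of the Hecke eigenvalue `λ_⋆(p)` of the unique window line:
`h(r_⋆) λ_⋆(p) = m_p(h) - Σ_{j ≠ ⋆} h(r_j) λ_j(p)` with `|Σ_{j ≠ ⋆}| ≤ C_p · tailHi`, then divide by
`h(r_⋆) ∈ hStar`. [folklore] -/
def muBox (p : ℕ) : QCBox := ((c.trace p).widen (c.C p * c.tailHi)).divPos c.hStar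

/-- Enclosure of the fingerprint quantity `λ_⋆(p)² · conj (χ p)`. [folklore] -/
def fpBox (p : ℕ) : QCBox := (c.muBox p).sq.mul (c.chiBox p)

/-- Rational enclosures of the icosahedral fingerprint set `Φ = {0, 1, 4, (3 ± √5)/2}`
(`tr(g)²/det(g)` for `g` of order `1, 2, 3, 5` in a two-dimensional representation of `A₅`).
[folklore] -/
def phiEnclosures : List QIvl :=
  [⟨0, 0⟩, ⟨1, 1⟩, ⟨4, 4⟩, ⟨2618033988 / 1000000000, 2618033989 / 1000000000⟩,
    ⟨381966011 / 1000000000, 381966012 / 1000000000⟩]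

/-- Certified VIOLATION of the fingerprint at `p`: the box of `λ_⋆(p)² conj χ(p)` is farther than
`fpTol` from every point of `Φ`. [folklore] -/
def violates (p : ℕ) : Bool :=
  phiEnclosures.all fun I => decide (c.fpTol ^ 2 < (c.fpBox p).distSqLower I)

/-- Certified MATCH of the fingerprint at `p`: the whole box of `λ_⋆(p)² conj χ(p)` is within
`fpTol` of some point of `Φ`. [folklore] -/
def matchesFp (p : ℕ) : Bool :=
  phiEnclosures.any fun I => decide ((c.fpBox p).distSqUpper I ≤ c.fpTol ^ 2)

/-- Structural well-formedness of the transcript (decidable bookkeeping, no mathematics):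
positive step and window bounds, the needed boxes are present, `0 < p`, and the recorded Hecke
bounds satisfy `σ(p)² ≤ p · C_p²`, `0 ≤ C_p` (so that `σ(p)/√p ≤ C_p`). [folklore] -/
def wellFormed : Bool :=
  decide (0 < c.maj.delta ∧ 0 < c.hlo ∧ c.hlo ≤ c.hhi ∧ 0 ≤ c.fpTol ∧ 0 ≤ c.window ∧
      (c.traces.lookup 1).isSome = true ∧
      ∀ p ∈ c.fpPrimes, 0 < p ∧ (c.traces.lookup p).isSome = true ∧ (c.chiBoxes.lookup p).isSome = true ∧
        0 ≤ c.C p ∧ ((ArithmeticFunction.sigma 1 p : ℕ) : ℚ) ^ 2 ≤ p * c.C p ^ 2) &&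
    match c.tail with
    | none => true
    | some (g, _) => decide (0 < g.delta)

/-- **Deficit verdict** (crux certified TRUE for this `χ`): no eigenvalue in the window (`U = 0`),
or exactly room for one (`U = 1`) and its fingerprint certifiedly violated at some `p`. [folklore] -/
def certifiesDeficit : Bool :=
  c.wellFormed && (c.upperCount == 0 || (c.upperCount == 1 && c.fpPrimes.any c.violates))

/-- **Sighting verdict** (crux certified FALSE for this `χ`): a window eigenvalue exists (`1 ≤ L`),
it is alone (`U = 1`), and its fingerprint matches at every `p`. [folklore] -/
def certifiesSighting : Bool :=
  c.wellFormed && (c.upperCount == 1 && decide (1 ≤ c.lowerCount) && c.fpPrimes.all c.matchesFp)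

end MaassHeckeTraceCensus

/-! ## 4. Semantics: Maass cusp forms on `(Γ₀(N), χ)`, Hecke operators, joint spectral data -/

/-- **Weight-`0` Maass cusp forms of level `N`, nebentypus `χ` and Laplace eigenvalue `λ`**
([BLS20, §1.1]: smooth `f` with `f(γ z) = χ(d) f(z)` for `γ = (a b; c d) ∈ Γ₀(N)`,
`∫_{Γ₀(N)\ℍ} |f|² < ∞`, `-y²(∂ₓ² + ∂_y²) f = λ f`), written in the tree's vocabulary
(`IsC2`, `hypLaplacian` with Iwaniec's sign, so `Δ u + λ u = 0`) and in the form used by route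
statements: square-integrability of the eigenfunction is replaced by the equivalent (for cusp
forms) pair "bounded" + "cuspidal", cuspidality being vanishing of the zeroth Fourier coefficient
at EVERY cusp, uniformly written as `∫₀^N u(g(x+iy)) dx = 0` for all `g ∈ SL₂(ℤ)` (the function
`x ↦ u(g(x+iy))` is `N`-periodic because `g T^N g⁻¹ ∈ Γ(N) ≤ Γ₀(N)` has `d ≡ 1 (N)`).
[cite: BookerLeeStrombergsson2020, §1.1] -/
structure IsMaassCuspFormOn (N : ℕ) (χ : DirichletCharacter ℂ N) (u : ℍ → ℂ) (lam : ℝ) : Prop where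
  /-- `u` is `C²` on `ℍ` -/
  isC2 : IsC2 u
  /-- `Δ u + λ u = 0` (Iwaniec's sign: `Δ = y²(∂ₓ² + ∂_y²)`) -/
  eigen : ∀ z, hypLaplacian u z + (lam : ℂ) * u z = 0
  /-- `u(γ z) = χ(d) u(z)` for `γ = (a b; c d) ∈ Γ₀(N)` -/
  slash : ∀ γ : Matrix.SpecialLinearGroup (Fin 2) ℤ, γ ∈ CongruenceSubgroup.Gamma0 N →
    ∀ z : ℍ, u (γ • z) = χ ((γ 1 1 : ℤ) : ZMod N) * u z
  /-- the period-`N` mean of `u` at every cusp `g · ∞` vanishes -/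
  cuspidal : ∀ (g : Matrix.SpecialLinearGroup (Fin 2) ℤ) (y : ℝ), 0 < y →
    ∫ x in (0 : ℝ)..(N : ℝ), u (g • UpperHalfPlane.ofComplex ((x : ℂ) + y * Complex.I)) = 0
  /-- `u` is bounded on `ℍ` -/
  bounded : ∃ C : ℝ, ∀ z, ‖u z‖ ≤ C

/-- **The Hecke operator `T_n`** (`n ≥ 1`) on functions with nebentypus `χ` mod `N`, unitary
normalisation: `(T_n u)(z) = n^{-1/2} Σ_{ad = n, d > 0} χ(a) Σ_{b mod d} u((az + b)/d)`
([BLS20, §1.1], there for `n` coprime to `N`; for other `n` the terms with `(a, N) > 1` vanish as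
`χ(a) = 0`). For a prime `p` this is `p^{-1/2} (Σ_{b < p} u((z+b)/p) + χ(p) u(pz))`.
[cite: BookerLeeStrombergsson2020, §1.1] -/
noncomputable def maassHeckeOp (N : ℕ) (χ : DirichletCharacter ℂ N) (n : ℕ) (u : ℍ → ℂ) (z : ℍ) : ℂ :=
  ((Real.sqrt n : ℝ) : ℂ)⁻¹ * ∑ d ∈ Nat.divisors n, χ ((n / d : ℕ) : ZMod N) *
    ∑ b ∈ Finset.range d, u (UpperHalfPlane.ofComplex ((((n / d : ℕ) : ℂ) * (z : ℂ) + (b : ℂ)) / (d : ℂ)))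

/-- For a prime `p`, `T_p u (z) = p^{-1/2} (Σ_{b < p} u((z + b)/p) + χ(p) u(p z))` — the shape
in which route statements inline `T_p`. [cite: BookerLeeStrombergsson2020, §1.1] -/
theorem maassHeckeOp_prime (N : ℕ) (χ : DirichletCharacter ℂ N) {p : ℕ} (hp : p.Prime) (u : ℍ → ℂ) (z : ℍ) :
    maassHeckeOp N χ p u z = ((Real.sqrt p : ℝ) : ℂ)⁻¹ *
      ((∑ b ∈ Finset.range p, u (UpperHalfPlane.ofComplex (((z : ℂ) + b) / p))) +
        χ (p : ZMod N) * u (UpperHalfPlane.ofComplex ((p : ℂ) * z))) := by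
  unfold maassHeckeOp
  rw [hp.divisors, Finset.sum_pair hp.one_lt.ne, Nat.div_one, Nat.div_self hp.pos]
  simp only [Finset.range_one, Finset.sum_singleton, Nat.cast_zero, add_zero, Nat.cast_one, div_one,
    one_mul, map_one]
  ring

/-- `T_n` as a `ℂ`-linear endomorphism of `ℍ → ℂ`. [folklore] -/
noncomputable def maassHeckeLM (N : ℕ) (χ : DirichletCharacter ℂ N) (n : ℕ) : (ℍ → ℂ) →ₗ[ℂ] (ℍ → ℂ) where
  toFun := maassHeckeOp N χ n
  map_add' u v := by
    funext z
    simp only [maassHeckeOp, Pi.add_apply, Finset.sum_add_distrib, mul_add]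
  map_smul' a u := by
    funext z
    simp only [maassHeckeOp, Pi.smul_apply, smul_eq_mul, RingHom.id_apply, Finset.mul_sum]
    exact Finset.sum_congr rfl fun _ _ => Finset.sum_congr rfl fun _ _ => by ring

/-- `maassHeckeLM` is `maassHeckeOp`. [folklore] -/
@[simp] theorem maassHeckeLM_apply (N : ℕ) (χ : DirichletCharacter ℂ N) (n : ℕ) (u : ℍ → ℂ) :
    maassHeckeLM N χ n u = maassHeckeOp N χ n u := rfl

namespace MaassHeckeTraceCensus

/-- One line of the joint cuspidal spectrum of `(Γ₀(N), χ)`: a Laplace eigenvalue `λ_j` and the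
Hecke eigenvalues `n ↦ λ_j(n)` of a joint eigenfunction. [folklore] -/
structure SpectralLine where
  /-- the Laplace eigenvalue `λ_j` (`= 1/4 + r_j²`) -/
  lam : ℝ
  /-- the Hecke eigenvalues `λ_j(n)` (only `n` in the census' index set are constrained) -/
  hecke : ℕ → ℂ

/-- **Joint spectral data.** `d : J → SpectralLine` lists, with multiplicity, the joint
(`Δ`, `T_n` for `n ∈ P`) cuspidal spectrum of weight `0` on `(Γ₀(N), χ)`: there is a linearly
independent family `u_j` of Maass cusp forms, `u_j` of eigenvalue `λ_j > 0` with
`T_n u_j = λ_j(n) u_j` (`n ∈ P`), `λ_j(1) = 1`, such that for every `λ` the `u_j` with `λ_j = λ`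
SPAN the space of Maass cusp forms of eigenvalue `λ` (a joint eigenbasis of each `A_λ(χ)`,
which exists as the `T_n`, `(n, N) = 1`, are commuting normal operators on the finite-dimensional
`A_λ(χ)` [BLS20, §1.1]); and the Hecke eigenvalues obey the trivial bound
`|λ_j(n)| ≤ σ(n)/√n` (the Hecke correspondence has degree `σ(n)`, so `‖T_n‖ ≤ σ(n)/√n` on `L²` by
Cauchy–Schwarz).
Sums `Σ_j h(r_j) λ_j(n)` over such data are the cuspidal traces `Σ_λ tr(T_n|A_λ(χ)) h(r_λ)`,
independently of the choice of the `u_j`. [cite: BookerLeeStrombergsson2020, §1.1] -/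
structure IsJointSpectralData (N : ℕ) (χ : DirichletCharacter ℂ N) (P : Finset ℕ) {J : Type*}
    (d : J → SpectralLine) : Prop where
  /-- cuspidal eigenvalues are positive -/
  lam_pos : ∀ j, 0 < (d j).lam
  /-- `T_1 = 1` -/
  hecke_one : ∀ j, (d j).hecke 1 = 1
  /-- the trivial Hecke bound `|λ_j(n)| √n ≤ σ(n)` -/
  norm_hecke_le : ∀ j, ∀ n ∈ P, ‖(d j).hecke n‖ * Real.sqrt n ≤ ArithmeticFunction.sigma 1 n
  /-- the data come from a linearly independent, complete family of joint eigen-cusp-forms -/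
  exists_eigenbasis : ∃ u : J → (ℍ → ℂ),
    (∀ j, IsMaassCuspFormOn N χ (u j) (d j).lam) ∧
    (∀ j, ∀ n ∈ P, maassHeckeOp N χ n (u j) = (d j).hecke n • u j) ∧
    LinearIndependent ℂ u ∧
    ∀ (v : ℍ → ℂ) (lam : ℝ), IsMaassCuspFormOn N χ v lam →
      v ∈ Submodule.span ℂ (u '' {j | (d j).lam = lam})

/-- **Joint eigenfunctions are located by joint spectral data**: a non-zero `v` in the span of a
linearly independent family of joint `T_n`-eigenfunctions `u_j` (`j ∈ S`), which is itself a
`T_n`-eigenfunction with eigenvalues `μ(n)`, has the same `T_n`-eigenvalues as some `u_j`, `j ∈ S`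
(expand `v`, apply `T_n`, compare coefficients). [folklore] -/
theorem exists_line_of_mem_span {N : ℕ} {χ : DirichletCharacter ℂ N} {J : Type*} {u : J → ℍ → ℂ}
    (hli : LinearIndependent ℂ u) {S : Set J} {v : ℍ → ℂ} (hv : v ∈ Submodule.span ℂ (u '' S))
    (hv0 : v ≠ 0) {P : List ℕ} {a : J → ℕ → ℂ} {μ : ℕ → ℂ}
    (hu : ∀ j, ∀ n ∈ P, maassHeckeOp N χ n (u j) = a j n • u j)
    (hvT : ∀ n ∈ P, maassHeckeOp N χ n v = μ n • v) :
    ∃ j ∈ S, ∀ n ∈ P, a j n = μ n := by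
  classical
  obtain ⟨l, hl, rfl⟩ := (Finsupp.mem_span_image_iff_linearCombination ℂ).mp hv
  have hl0 : l ≠ 0 := by
    rintro rfl; exact hv0 (by simp)
  obtain ⟨i₀, hi₀⟩ := Finsupp.support_nonempty_iff.mpr hl0
  refine ⟨i₀, hl (by simpa using hi₀), fun n hn => ?_⟩
  have hexp : Finsupp.linearCombination ℂ u l = ∑ i ∈ l.support, l i • u i :=
    Finsupp.linearCombination_apply ℂ l
  have h1 : maassHeckeOp N χ n (Finsupp.linearCombination ℂ u l) = ∑ i ∈ l.support, (l i * a i n) • u i := by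
    rw [hexp, ← maassHeckeLM_apply, map_sum]
    refine Finset.sum_congr rfl fun i _ => ?_
    rw [LinearMap.map_smul, maassHeckeLM_apply, hu i n hn, smul_smul]
  have h2 : μ n • Finsupp.linearCombination ℂ u l = ∑ i ∈ l.support, (μ n * l i) • u i := by
    rw [hexp, Finset.smul_sum]
    exact Finset.sum_congr rfl fun i _ => by rw [smul_smul]
  have h3 : ∑ i ∈ l.support, (l i * a i n - μ n * l i) • u i = 0 := by
    simp only [sub_smul, Finset.sum_sub_distrib, ← h1, ← h2, hvT n hn, sub_self]
  have h4 := linearIndependent_iff'.mp hli l.support (fun i => l i * a i n - μ n * l i) h3 i₀ hi₀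
  have hli₀ : l i₀ ≠ 0 := Finsupp.mem_support_iff.mp hi₀
  have : l i₀ * (a i₀ n - μ n) = 0 := by rw [mul_sub]; linear_combination h4
  rcases mul_eq_zero.mp this with h | h
  · exact absurd h hli₀
  · exact sub_eq_zero.mp h

end MaassHeckeTraceCensus

/-- The icosahedral fingerprint set `Φ = {0, 1, 4, (3 ± √5)/2}`: the values of `tr(g)²/det(g)`
for `g` of order `1, 2, 3, 5` in a two-dimensional (projectively `A₅`) representation. [folklore] -/
def icosahedralFingerprint : Set ℂ :=
  {0, 1, 4, (((3 + Real.sqrt 5) / 2 : ℝ) : ℂ), (((3 - Real.sqrt 5) / 2 : ℝ) : ℂ)}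

/-- `2.236067976 ≤ √5 ≤ 2.236067978`. [folklore] -/
theorem sqrt_five_enclosure :
    (2236067976 / 1000000000 : ℝ) ≤ Real.sqrt 5 ∧ Real.sqrt 5 ≤ 2236067978 / 1000000000 := by
  constructor
  · rw [Real.le_sqrt (by norm_num)] <;> norm_num
  · rw [Real.sqrt_le_left (by norm_num)]; norm_num

namespace MaassHeckeTraceCensus

/-- Every point of `Φ` is a real number lying in one of the `phiEnclosures`. [folklore] -/
theorem exists_enclosure_of_mem_fingerprint {φ : ℂ} (hφ : φ ∈ icosahedralFingerprint) :
    ∃ I ∈ phiEnclosures, ∃ x : ℝ, I.mem x ∧ (x : ℂ) = φ := by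
  obtain ⟨h5, h5'⟩ := sqrt_five_enclosure
  simp only [icosahedralFingerprint, Set.mem_insert_iff, Set.mem_singleton_iff] at hφ
  rcases hφ with rfl | rfl | rfl | rfl | rfl
  · exact ⟨⟨0, 0⟩, by simp [phiEnclosures], 0, ⟨by simp, by simp⟩, by simp⟩
  · exact ⟨⟨1, 1⟩, by simp [phiEnclosures], 1, ⟨by simp, by simp⟩, by simp⟩
  · exact ⟨⟨4, 4⟩, by simp [phiEnclosures], 4, ⟨by simp, by simp⟩, by simp⟩
  · refine ⟨⟨2618033988 / 1000000000, 2618033989 / 1000000000⟩, by simp [phiEnclosures],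
      (3 + Real.sqrt 5) / 2, ⟨?_, ?_⟩, rfl⟩ <;> push_cast <;> linarith
  · refine ⟨⟨381966011 / 1000000000, 381966012 / 1000000000⟩, by simp [phiEnclosures],
      (3 - Real.sqrt 5) / 2, ⟨?_, ?_⟩, rfl⟩ <;> push_cast <;> linarith

/-- Every enclosure in `phiEnclosures` contains a point of `Φ`. [folklore] -/
theorem exists_mem_fingerprint_of_mem_enclosures {I : QIvl} (hI : I ∈ phiEnclosures) :
    ∃ x : ℝ, I.mem x ∧ (x : ℂ) ∈ icosahedralFingerprint := by
  obtain ⟨h5, h5'⟩ := sqrt_five_enclosure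
  simp only [phiEnclosures, List.mem_cons, List.not_mem_nil, or_false] at hI
  rcases hI with rfl | rfl | rfl | rfl | rfl
  · exact ⟨0, ⟨by simp, by simp⟩, by simp [icosahedralFingerprint]⟩
  · exact ⟨1, ⟨by simp, by simp⟩, by simp [icosahedralFingerprint]⟩
  · exact ⟨4, ⟨by simp, by simp⟩, by simp [icosahedralFingerprint]⟩
  · refine ⟨(3 + Real.sqrt 5) / 2, ⟨?_, ?_⟩, by simp [icosahedralFingerprint]⟩ <;> push_cast <;> linarith
  · refine ⟨(3 - Real.sqrt 5) / 2, ⟨?_, ?_⟩, by simp [icosahedralFingerprint]⟩ <;> push_cast <;> linarith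

variable (c : MaassHeckeTraceCensus)

/-- The Hecke indices whose traces the census records: `1` and the fingerprint primes. [folklore] -/
def indices : Finset ℕ := insert 1 c.fpPrimes.toFinset

/-- The eigenvalue window `|λ - 1/4| ≤ window`. [folklore] -/
def inWindow (lam : ℝ) : Prop := |lam - 1 / 4| ≤ (c.window : ℝ)

/-- **What the boxes of a census assert about joint spectral data `d`** (the content certified by
the interval-arithmetic run): every recorded trace box contains `Σ_j h(r_j) λ_j(n)` (an absolutely
convergent sum); `hlo ≤ h ≤ hhi` on the window (a statement about the explicit trigonometric
function `h`, certified by interval evaluation); the `χ`-boxes contain `conj χ(p)`; and, if a tail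
slot `(g, B)` is present, `B ∋ Σ_j g(r_j)` and `h ≤ g` off the window. [cite: BookerLeeStrombergsson2020, §5] -/
structure EnclosesSpectralData {N : ℕ} (χ : DirichletCharacter ℂ N) {J : Type*} (d : J → SpectralLine) :
    Prop where
  /-- the box of `m_n(h)` contains `Σ_j h(r_j) λ_j(n)` -/
  trace_mem : ∀ n ∈ c.indices, ∃ s : ℂ,
    HasSum (fun j => ((c.maj.eval (d j).lam : ℝ) : ℂ) * (d j).hecke n) s ∧ (c.trace n).mem s
  /-- `hlo ≤ h(r_λ) ≤ hhi` for `λ > 0` in the window -/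
  window_bounds : ∀ lam : ℝ, 0 < lam → c.inWindow lam →
    (c.hlo : ℝ) ≤ c.maj.eval lam ∧ c.maj.eval lam ≤ c.hhi
  /-- the `χ`-boxes contain `conj χ(p)` -/
  chi_mem : ∀ p ∈ c.fpPrimes, (c.chiBox p).mem (starRingEnd ℂ (χ (p : ZMod N)))
  /-- the tail slot: `B ∋ Σ_j g(r_j)` and `h ≤ g` off the window -/
  tail_spec : ∀ (g : SqTestFn) (B : QIvl), c.tail = some (g, B) →
    (∃ t : ℝ, HasSum (fun j => g.eval (d j).lam) t ∧ B.mem t) ∧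
    ∀ lam : ℝ, 0 < lam → ¬ c.inWindow lam → c.maj.eval lam ≤ g.eval lam

end MaassHeckeTraceCensus

/-- **Certified Maass–Hecke trace census** (the notion requested by route
`Langlands/QuarterDeficit1951`): the census `c` is a well-formed transcript for level `N` whose boxes
enclose the `h`-weighted Hecke traces of SOME joint spectral data of `(Γ₀(N), χ)` — i.e. of the true
weight-`0` cuspidal spectrum, listed with multiplicity through a joint eigenbasis. This is the
statement an Arb run of a Selberg–Hecke trace formula evaluator certifies (verdict class
"computation": no in-kernel checker of the enclosures is claimed); the decoding theorems below turn
it, together with the kernel-decidable verdicts `certifiesDeficit` / `certifiesSighting`, into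
statements about Maass cusp forms. [cite: BookerLeeStrombergsson2020, §1.1, §5] -/
def CertifiedMaassHeckeTraceCensus (N : ℕ) (χ : DirichletCharacter ℂ N) (c : MaassHeckeTraceCensus) : Prop :=
  c.level = N ∧ c.wellFormed = true ∧
    ∃ (J : Type) (d : J → MaassHeckeTraceCensus.SpectralLine),
      MaassHeckeTraceCensus.IsJointSpectralData N χ c.indices d ∧ c.EnclosesSpectralData χ d

/-! ## 5. Soundness of the post-processing and the two decoding theorems -/

namespace MaassHeckeTraceCensus

variable {c : MaassHeckeTraceCensus} {N : ℕ} {χ : DirichletCharacter ℂ N} {J : Type*} {d : J → SpectralLine}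

/-- The arithmetic content of `wellFormed`. [folklore] -/
theorem wellFormed_spec (h : c.wellFormed = true) :
    0 < c.maj.delta ∧ 0 < c.hlo ∧ c.hlo ≤ c.hhi ∧ 0 ≤ c.fpTol ∧ 0 ≤ c.window ∧
      (c.traces.lookup 1).isSome = true ∧
      ∀ p ∈ c.fpPrimes, 0 < p ∧ (c.traces.lookup p).isSome = true ∧ (c.chiBoxes.lookup p).isSome = true ∧
        0 ≤ c.C p ∧ ((ArithmeticFunction.sigma 1 p : ℕ) : ℚ) ^ 2 ≤ p * c.C p ^ 2 := by
  unfold wellFormed at h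
  rw [Bool.and_eq_true] at h
  exact of_decide_eq_true h.1

section Core

variable (hJ : IsJointSpectralData N χ c.indices d) (hE : c.EnclosesSpectralData χ d)
  (hw : c.wellFormed = true)
include hJ hE

/-- The total mass `S = Σ_j h(r_j)` exists and lies in the recorded box of `m_1(h)`. [folklore] -/
theorem exists_hasSum_weights :
    ∃ S : ℝ, HasSum (fun j => c.maj.eval (d j).lam) S ∧ (c.m1lo : ℝ) ≤ S ∧ S ≤ c.m1hi := by
  obtain ⟨s, hs, hmem⟩ := hE.trace_mem 1 (Finset.mem_insert_self _ _)
  have hfun : (fun j => ((c.maj.eval (d j).lam : ℝ) : ℂ) * (d j).hecke 1) =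
      fun j => ((c.maj.eval (d j).lam : ℝ) : ℂ) := funext fun j => by rw [hJ.hecke_one, mul_one]
  have hs' : HasSum (fun j => ((c.maj.eval (d j).lam : ℝ) : ℂ)) s := by rwa [hfun] at hs
  have hre := Complex.reCLM.hasSum hs'
  simp only [Complex.reCLM_apply, Complex.ofReal_re] at hre
  exact ⟨s.re, hre, hmem.1.1, hmem.1.2⟩

/-- A window line has weight `h(r_j) ≥ hlo`, and `≤ hhi`. [folklore] -/
theorem hlo_le_weight {j : J} (hj : c.inWindow (d j).lam) :
    (c.hlo : ℝ) ≤ c.maj.eval (d j).lam ∧ c.maj.eval (d j).lam ≤ c.hhi :=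
  hE.window_bounds _ (hJ.lam_pos j) hj

include hw

/-- **Soundness of the upper count, `U = 0`**: no eigenvalue lies in the window. [cite: BookerLeeStrombergsson2020, §5] -/
theorem not_inWindow_of_upperCount_eq_zero (hU : c.upperCount = 0) (j : J) : ¬ c.inWindow (d j).lam := by
  intro hj
  obtain ⟨S, hS, -, hShi⟩ := exists_hasSum_weights hJ hE
  have hlo := (wellFormed_spec hw).2.1
  have h1 := (hlo_le_weight hJ hE hj).1
  have h2 : c.maj.eval (d j).lam ≤ S := le_hasSum hS j fun i _ => c.maj.eval_nonneg _
  have h3 : c.m1hi / c.hlo < 1 := by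
    have := Nat.lt_floor_add_one (c.m1hi / c.hlo)
    rw [upperCount] at hU
    rw [hU] at this
    simpa using this
  have h4 : c.m1hi < c.hlo := by rwa [div_lt_one hlo] at h3
  have h5 : (c.m1hi : ℝ) < c.hlo := by exact_mod_cast h4
  linarith

/-- **Soundness of the upper count, `U = 1`**: at most one line lies in the window. [cite: BookerLeeStrombergsson2020, §5] -/
theorem window_subsingleton_of_upperCount_eq_one (hU : c.upperCount = 1) {j j' : J}
    (hj : c.inWindow (d j).lam) (hj' : c.inWindow (d j').lam) : j = j' := by
  classical
  by_contra hne
  obtain ⟨S, hS, -, hShi⟩ := exists_hasSum_weights hJ hE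
  have hlo := (wellFormed_spec hw).2.1
  have h1 := (hlo_le_weight hJ hE hj).1
  have h1' := (hlo_le_weight hJ hE hj').1
  have h2 : ∑ i ∈ ({j, j'} : Finset J), c.maj.eval (d i).lam ≤ S :=
    sum_le_hasSum _ (fun i _ => c.maj.eval_nonneg _) hS
  rw [Finset.sum_pair hne] at h2
  have h3 : c.m1hi / c.hlo < 2 := by
    have := Nat.lt_floor_add_one (c.m1hi / c.hlo)
    rw [upperCount] at hU
    rw [hU] at this
    norm_num at this
    exact this
  have h4 : c.m1hi < 2 * c.hlo := by rwa [div_lt_iff₀ hlo] at h3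
  have h5 : (c.m1hi : ℝ) < 2 * c.hlo := by exact_mod_cast h4
  linarith

omit hw in
/-- **Tail bound**: if `⋆` is the only window line then `Σ_{j ≠ ⋆} h(r_j) ≤ tailHi`. [folklore] -/
theorem tail_le {j₀ : J} (hj₀ : c.inWindow (d j₀).lam) (huniq : ∀ j, c.inWindow (d j).lam → j = j₀)
    {S : ℝ} (hS : HasSum (fun j => c.maj.eval (d j).lam) S) (hShi : S ≤ c.m1hi) :
    S - c.maj.eval (d j₀).lam ≤ c.tailHi := by
  classical
  have hlo := (hlo_le_weight hJ hE hj₀).1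
  have hA : S - c.maj.eval (d j₀).lam ≤ (c.m1hi : ℝ) - c.hlo := by linarith
  unfold tailHi
  rcases htail : c.tail with _ | ⟨g, B⟩
  · push_cast; exact hA
  · simp only
    obtain ⟨⟨t, ht, htB⟩, hdom⟩ := hE.tail_spec g B htail
    have hsub := hasSum_ite_sub_hasSum hS j₀
    have hB : S - c.maj.eval (d j₀).lam ≤ t := by
      refine hasSum_le (fun j => ?_) hsub ht
      split_ifs with h
      · exact g.eval_nonneg _
      · exact hdom _ (hJ.lam_pos j) fun hw' => h (huniq j hw')
    push_cast
    exact le_min (hB.trans htB.2) hA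

/-- **Location of `h(r_⋆)`**: the weight of the unique window line lies in `hStar`, a positive interval. [folklore] -/
theorem weight_mem_hStar {j₀ : J} (hj₀ : c.inWindow (d j₀).lam) (huniq : ∀ j, c.inWindow (d j).lam → j = j₀) :
    c.hStar.mem (c.maj.eval (d j₀).lam) ∧ 0 < c.hStar.lo := by
  obtain ⟨S, hS, hSlo, hShi⟩ := exists_hasSum_weights hJ hE
  have hlo := (wellFormed_spec hw).2.1
  obtain ⟨h1, h1'⟩ := hlo_le_weight hJ hE hj₀
  have h2 : c.maj.eval (d j₀).lam ≤ S := le_hasSum hS j₀ fun i _ => c.maj.eval_nonneg _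
  have h3 := tail_le hJ hE hj₀ huniq hS hShi
  refine ⟨⟨?_, ?_⟩, lt_max_of_lt_left hlo⟩
  · simp only [hStar]; push_cast
    exact max_le h1 (by linarith)
  · simp only [hStar]; push_cast
    exact le_min h1' (h2.trans hShi)

omit hE in
/-- The trivial Hecke bound in the recorded rational form: `|λ_j(p)| ≤ C_p`. [folklore] -/
theorem norm_hecke_le_C {p : ℕ} (hp : p ∈ c.fpPrimes) (j : J) : ‖(d j).hecke p‖ ≤ c.C p := by
  obtain ⟨hp0, -, -, hC0, hσ⟩ := (wellFormed_spec hw).2.2.2.2.2.2 p hp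
  have h1 := hJ.norm_hecke_le j p (Finset.mem_insert_of_mem (List.mem_toFinset.mpr hp))
  have hσ' : ((ArithmeticFunction.sigma 1 p : ℕ) : ℝ) ^ 2 ≤ (p : ℝ) * (c.C p : ℝ) ^ 2 := by
    exact_mod_cast hσ
  have hC0' : (0 : ℝ) ≤ c.C p := by exact_mod_cast hC0
  have hsq : (0 : ℝ) < Real.sqrt p := Real.sqrt_pos.mpr (by exact_mod_cast hp0)
  by_contra hlt
  push Not at hlt
  have h2 : (c.C p : ℝ) * Real.sqrt p < ‖(d j).hecke p‖ * Real.sqrt p := mul_lt_mul_of_pos_right hlt hsq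
  have h3 : ((c.C p : ℝ) * Real.sqrt p) ^ 2 < ((ArithmeticFunction.sigma 1 p : ℕ) : ℝ) ^ 2 :=
    pow_lt_pow_left₀ (h2.trans_le h1) (by positivity) two_ne_zero
  rw [mul_pow, Real.sq_sqrt (by positivity)] at h3
  linarith

/-- **Extraction of Hecke eigenvalues**: if `⋆` is the only window line then `λ_⋆(p) ∈ muBox p`.
[folklore] -/
theorem hecke_mem_muBox {j₀ : J} (hj₀ : c.inWindow (d j₀).lam) (huniq : ∀ j, c.inWindow (d j).lam → j = j₀)
    {p : ℕ} (hp : p ∈ c.fpPrimes) : (c.muBox p).mem ((d j₀).hecke p) := by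
  classical
  obtain ⟨S, hS, hSlo, hShi⟩ := exists_hasSum_weights hJ hE
  obtain ⟨s, hs, hsmem⟩ := hE.trace_mem p (Finset.mem_insert_of_mem (List.mem_toFinset.mpr hp))
  have hWnn : ∀ j, 0 ≤ c.maj.eval (d j).lam := fun j => c.maj.eval_nonneg _
  obtain ⟨-, -, -, hC0, -⟩ := (wellFormed_spec hw).2.2.2.2.2.2 p hp
  -- the off-window part E = s - W⋆ λ⋆(p)
  have hEsum := hasSum_ite_sub_hasSum hs j₀
  have hTsum := (hasSum_ite_sub_hasSum hS j₀).mul_right (c.C p : ℝ)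
  have hnorm : ‖s - ((c.maj.eval (d j₀).lam : ℝ) : ℂ) * (d j₀).hecke p‖ ≤
      (S - c.maj.eval (d j₀).lam) * c.C p := by
    refine HasSum.norm_le_of_bounded hEsum hTsum fun j => ?_
    by_cases h : j = j₀
    · simp [h]
    · simp only [h, if_false, norm_mul, Complex.norm_real, Real.norm_eq_abs, abs_of_nonneg (hWnn j)]
      exact mul_le_mul_of_nonneg_left (norm_hecke_le_C hJ hw hp j) (hWnn j)
  have htail := tail_le hJ hE hj₀ huniq hS hShi
  have hC0' : (0 : ℝ) ≤ c.C p := by exact_mod_cast hC0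
  have hbound : ‖((c.maj.eval (d j₀).lam : ℝ) : ℂ) * (d j₀).hecke p - s‖ ≤ ((c.C p * c.tailHi : ℚ) : ℝ) := by
    rw [norm_sub_rev]; push_cast
    calc ‖s - ((c.maj.eval (d j₀).lam : ℝ) : ℂ) * (d j₀).hecke p‖
        ≤ (S - c.maj.eval (d j₀).lam) * c.C p := hnorm
      _ ≤ c.tailHi * c.C p := mul_le_mul_of_nonneg_right htail hC0'
      _ = c.C p * c.tailHi := mul_comm _ _
  have hwid : ((c.trace p).widen (c.C p * c.tailHi)).mem (((c.maj.eval (d j₀).lam : ℝ) : ℂ) * (d j₀).hecke p) := by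
    have := QCBox.mem_widen hsmem hbound
    simpa using this
  obtain ⟨hmem, hpos⟩ := weight_mem_hStar hJ hE hw hj₀ huniq
  have hW0 : ((c.maj.eval (d j₀).lam : ℝ) : ℂ) ≠ 0 := by
    have : (0 : ℝ) < c.maj.eval (d j₀).lam :=
      (show (0 : ℝ) < c.hStar.lo by exact_mod_cast hpos).trans_le hmem.1
    exact_mod_cast this.ne'
  have := QCBox.mem_divPos hwid hmem hpos
  rwa [mul_div_cancel_left₀ _ hW0] at this

/-- The fingerprint quantity of the unique window line lies in `fpBox p`. [folklore] -/
theorem fp_mem_fpBox {j₀ : J} (hj₀ : c.inWindow (d j₀).lam) (huniq : ∀ j, c.inWindow (d j).lam → j = j₀)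
    {p : ℕ} (hp : p ∈ c.fpPrimes) :
    (c.fpBox p).mem ((d j₀).hecke p ^ 2 * starRingEnd ℂ (χ (p : ZMod N))) :=
  QCBox.mem_mul (QCBox.mem_sq (hecke_mem_muBox hJ hE hw hj₀ huniq hp)) (hE.chi_mem p hp)

/-- **Soundness of the lower count**: `1 ≤ L` forces a line in the window. [folklore] -/
theorem exists_inWindow_of_one_le_lowerCount (hL : 1 ≤ c.lowerCount) : ∃ j, c.inWindow (d j).lam := by
  classical
  obtain ⟨S, hS, hSlo, -⟩ := exists_hasSum_weights hJ hE
  have hhi : 0 < c.hhi := (wellFormed_spec hw).2.1.trans_le (wellFormed_spec hw).2.2.1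
  unfold lowerCount at hL
  rcases htail : c.tail with _ | ⟨g, B⟩
  · simp [htail] at hL
  · simp only [htail] at hL
    have hpos : 0 < (c.m1lo - B.hi) / c.hhi := Nat.ceil_pos.mp hL
    have hlt : B.hi < c.m1lo := by
      have := (div_pos_iff_of_pos_right hhi).mp hpos
      linarith
    obtain ⟨⟨t, ht, htB⟩, hdom⟩ := hE.tail_spec g B htail
    by_contra hno
    push Not at hno
    have hle : S ≤ t := hasSum_le (fun j => hdom _ (hJ.lam_pos j) (hno j)) hS ht
    have : (B.hi : ℝ) < c.m1lo := by exact_mod_cast hlt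
    linarith [htB.2]

end Core

/-- **Decoding theorem I (deficit).** If `c` is a certified census for `(N, χ)` with the deficit
verdict, then every non-zero weight-`0` Maass cusp form on `(Γ₀(N), χ)` with eigenvalue in the
window which is a `T_p`-eigenfunction for the fingerprint primes VIOLATES the icosahedral
fingerprint by more than `fpTol` at some `p` (when `U = 0` there is no such form at all and the
conclusion holds vacuously). [cite: BookerLeeStrombergsson2020, §5] -/
theorem not_fingerprinted {c : MaassHeckeTraceCensus} {N : ℕ} {χ : DirichletCharacter ℂ N}
    (hc : CertifiedMaassHeckeTraceCensus N χ c) (hv : c.certifiesDeficit = true)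
    {u : ℍ → ℂ} {lam : ℝ} {μ : ℕ → ℂ} (hu : IsMaassCuspFormOn N χ u lam) (hne : ∃ z, u z ≠ 0)
    (hwin : |lam - 1 / 4| ≤ (c.window : ℝ)) (hT : ∀ p ∈ c.fpPrimes, maassHeckeOp N χ p u = μ p • u) :
    ∃ p ∈ c.fpPrimes, ∀ φ ∈ icosahedralFingerprint,
      (c.fpTol : ℝ) < ‖μ p ^ 2 * starRingEnd ℂ (χ (p : ZMod N)) - φ‖ := by
  unfold CertifiedMaassHeckeTraceCensus at hc
  obtain ⟨-, hw, J, d, hJ, hE⟩ := hc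
  obtain ⟨ub, hform, hHecke, hli, hspan⟩ := hJ.exists_eigenbasis
  have hu0 : u ≠ 0 := by
    obtain ⟨z, hz⟩ := hne
    exact fun h => hz (by simp [h])
  have hsub : ∀ p ∈ c.fpPrimes, p ∈ c.indices := fun p hp =>
    Finset.mem_insert_of_mem (List.mem_toFinset.mpr hp)
  obtain ⟨j₀, hj₀, hμ⟩ := exists_line_of_mem_span hli (hspan u lam hu) hu0 (P := c.fpPrimes)
    (a := fun j n => (d j).hecke n) (fun j n hn => hHecke j n (hsub n hn)) hT
  have hj₀win : c.inWindow (d j₀).lam := by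
    simp only [Set.mem_setOf_eq] at hj₀
    rw [inWindow, hj₀]; exact hwin
  unfold certifiesDeficit at hv
  simp only [Bool.and_eq_true, Bool.or_eq_true, beq_iff_eq, List.any_eq_true] at hv
  obtain ⟨-, hU | ⟨hU, p, hp, hviol⟩⟩ := hv
  · exact absurd hj₀win (not_inWindow_of_upperCount_eq_zero hJ hE hw hU j₀)
  · have huniq : ∀ j, c.inWindow (d j).lam → j = j₀ := fun j hj =>
      window_subsingleton_of_upperCount_eq_one hJ hE hw hU hj hj₀win
    refine ⟨p, hp, fun φ hφ => ?_⟩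
    have hq := fp_mem_fpBox hJ hE hw hj₀win huniq hp
    rw [hμ p hp] at hq
    obtain ⟨I, hI, x, hx, rfl⟩ := exists_enclosure_of_mem_fingerprint hφ
    unfold violates at hviol
    have hI' := (List.all_eq_true.mp hviol) I hI
    have hlt : (c.fpTol : ℝ) ^ 2 < ((c.fpBox p).distSqLower I : ℝ) := by
      exact_mod_cast of_decide_eq_true hI'
    have hle := QCBox.distSqLower_le hq hx
    exact lt_of_pow_lt_pow_left₀ 2 (norm_nonneg _) (hlt.trans_le hle)

/-- **Decoding theorem II (sighting).** If `c` is a certified census for `(N, χ)` with the sighting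
verdict, then there IS a non-zero weight-`0` Maass cusp form on `(Γ₀(N), χ)` with eigenvalue in the
window, a `T_p`-eigenfunction for every fingerprint prime `p`, whose fingerprint quantities
`μ_p² conj χ(p)` are each within `fpTol` of `Φ`. [cite: BookerLeeStrombergsson2020, §5] -/
theorem exists_fingerprinted {c : MaassHeckeTraceCensus} {N : ℕ} {χ : DirichletCharacter ℂ N}
    (hc : CertifiedMaassHeckeTraceCensus N χ c) (hv : c.certifiesSighting = true) :
    ∃ (u : ℍ → ℂ) (lam : ℝ), IsMaassCuspFormOn N χ u lam ∧ (∃ z, u z ≠ 0) ∧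
      |lam - 1 / 4| ≤ (c.window : ℝ) ∧
      ∀ p ∈ c.fpPrimes, ∃ μ φ : ℂ, φ ∈ icosahedralFingerprint ∧ maassHeckeOp N χ p u = μ • u ∧
        ‖μ ^ 2 * starRingEnd ℂ (χ (p : ZMod N)) - φ‖ ≤ c.fpTol := by
  unfold CertifiedMaassHeckeTraceCensus at hc
  obtain ⟨-, hw, J, d, hJ, hE⟩ := hc
  obtain ⟨ub, hform, hHecke, hli, hspan⟩ := hJ.exists_eigenbasis
  unfold certifiesSighting at hv
  simp only [Bool.and_eq_true, beq_iff_eq, List.all_eq_true, decide_eq_true_eq] at hv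
  obtain ⟨-, ⟨hU, hL⟩, hmatch⟩ := hv
  obtain ⟨j₀, hj₀win⟩ := exists_inWindow_of_one_le_lowerCount hJ hE hw hL
  have huniq : ∀ j, c.inWindow (d j).lam → j = j₀ := fun j hj =>
    window_subsingleton_of_upperCount_eq_one hJ hE hw hU hj hj₀win
  have htol : (0 : ℝ) ≤ c.fpTol := by exact_mod_cast (wellFormed_spec hw).2.2.2.1
  refine ⟨ub j₀, (d j₀).lam, hform j₀, ?_, hj₀win, fun p hp => ?_⟩
  · by_contra h
    push Not at h
    exact hli.ne_zero j₀ (funext h)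
  · have hq := fp_mem_fpBox hJ hE hw hj₀win huniq hp
    obtain ⟨I, hI, hup⟩ := List.any_eq_true.mp (hmatch p hp)
    obtain ⟨x, hx, hxΦ⟩ := exists_mem_fingerprint_of_mem_enclosures hI
    refine ⟨(d j₀).hecke p, x, hxΦ, hHecke j₀ p (Finset.mem_insert_of_mem (List.mem_toFinset.mpr hp)), ?_⟩
    have hle : ((c.fpBox p).distSqUpper I : ℝ) ≤ (c.fpTol : ℝ) ^ 2 := by
      exact_mod_cast of_decide_eq_true hup
    have h2 := QCBox.normSq_le_distSqUpper hq hx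
    exact le_of_pow_le_pow_left₀ two_ne_zero htol (h2.trans hle)

end MaassHeckeTraceCensus

end Literature.NumberTheory.Automorphic
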